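import Literature.MathematicalPhysics.QuantumFieldTheory.Balaban1983to89.T4Crossover
import Mathlib.Analysis.Normed.Ring.InfiniteSum
import Mathlib.Analysis.PSeries

/-!
# NODE N17 (NE4) → THE N19′ CORE EDGE OF K3⁷: THE TRANSPORT THRESHOLD — WHICH TWO-RUN INJECTED MODULI SURVIVE THE SPINE'S CROSSOVER
# (a summable modulus does NOT; every `p`-summable one with an admissible exponent does; geometric = the tree's case)

Cell `pub-ymgap`, YM-PLAN Track A (HUMAN RULING D-0062 ∕ D-0149), WIDTH SEAT `pub-ymgap-dag-n17-w2` (gen 3), key K3⁷ stmt-QuantumFields-20544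
(`--kind proof --supports 20544 --as helper`, COUNT-NEUTRAL).  Successor piece of this seat's gen-2 README note (pub-ymgap INBOX l.26851, booked by plan g81):
gen 2 proved that K2⁷'s LINE 2 «shift-cauchy-everyslope» consumes node N17 only through a SUMMABLE two-run scale-shift modulus of the full β
(`N17ShiftModulusAnchorRecord13.everySlope13_of_summableShift_anchor`, p595586) and exhibited a β with a summable but NOT geometric modulus
(`N17ShiftModulusAnchor.summable_shiftModulus_anchor_not_geometric`, p595280), leaving ONE located question: does K3⁷'s N19′ core edge read node N17
only through a summable two-run discrepancy too, so that K3⁷'s N17 conjunct could carry the same hedge?  THIS FILE ANSWERS IT IN THE KERNEL: **NO**.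

THE READING OF RECORD (tree, cited BY NAME, nothing restated).  K3⁷ v3 (`HOME/pub-ymgap-plan/D81-K3V3/K3Skeleton13SepCoPHv3.lean` 02f6f498332fdbee) passes the
rates `P := PHolderD4 β` through leaf D `BalabanUVNodesN27SpineRecord.spineGivenEndpointR13SepCoPH_of_keyedFacesP` UNTOUCHED into the N19′ face
`KeyedCoreEdgeHolderD4 β cr rr` («GIVEN the rates, `∃ δ, NE7.Core … δ ∧ Summable δ`»), so node N17 is read INSIDE the N19′ edge only.  That edge of record,
`BalabanUVNodes.N19RateEdge.rateEdge_of_linkReading`, consumes N14 ∕ N18 ∕ N22 from `RatesAt D R` BY NAME and reads N17 ONLY as the liaison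
`T4CauchySum.InjectedRate Cd 0 θc (fun K j ↦ disc (g K) (g (K+1)) j)` — node U2's OUTPUT (`T4CouplingMatching.injectedRate_of_runs_eventual` ⟸
`ScaleShiftRate c θc γ β` = `YMDAG.UVSplit.N17At`), a GEOMETRIC modulus `Cd·θc^j` in the injection scale `j`, uniform in the cutoff `K` (§3 below,
`injectedRate_zero_iff_geometric_modulus`).  Down the knit (`N19MultiplicityByName` → `N19SizeByName` → … → `N19CoreKnit.core_summable_of_termBudget`) the
remainder is `δ K = max(Cw,1)·(E_K + Cr)·Σ_{j+n=K} min(aⁿ, θ′^j·Λⁿ) + rO K + s K` with «a common rate `θ′ < 1` above `max(ω, θc)`, `θ₅`, `θ₃` and below the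
multiplicity base `Λ`» (`N19CoreKnit.core_summable_of_spineNodes`), and `Summable δ` is `T4Crossover.summable_sum_min_pow`: the crossover of the recent-scale
RATE `θ′^j` against the MULTIPLICITY `Λⁿ = (L⁴)ⁿ` of scale-`j` domains ([Balaban1987RG1] (0.26) p. 257) and the old-scale contraction `aⁿ = L^{−βn}`
([Balaban1988Convergent] Thm 2 (2.43) p. 263).  The printed reason the coupling bracket needs a RATE and not a uniform discrepancy is
[GawedzkiKupiainen1985] (142)–(143) («the MARGINAL direction does not contract»; header of `T4TowerRateComposition`).

WHAT THIS FILE PROVES (theorems only; 0 `def`, 0 `instance`, 0 `notation`, 0 `sorry`), in `T4Crossover`'s currency `Σ_{x ∈ antidiagonal K} min (a^{x.2}) (r x.1 · Λ^{x.2})`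
with a GENERAL injected modulus `r : ℕ → ℝ` in place of the geometric `θ^{x.1}`:
§1 THE THRESHOLD (sufficiency).  `min_le_rpow_modulus_mul_pow` (one term: `min(aⁿ, r_j·Λⁿ) ≤ r_j^p · (a^{1−p}·Λ^p)ⁿ`, two-point interpolation
`T4Crossover.min_le_rpow_mul_rpow`); `sum_min_modulus_le`; ★ `summable_crossover_of_rpowSummable`: `a, Λ ≥ 0`, `r ≥ 0`, `0 ≤ p ≤ 1`, `a^{1−p}·Λ^p < 1` and
`Σ_j r_j^p < ∞` ⟹ `K ↦ Σ_{j+n=K} min(aⁿ, r_j·Λⁿ)` is summable (Cauchy product of `r^p` with the geometric `(a^{1−p}Λ^p)ⁿ`); the ADMISSIBLE EXPONENTS: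
`admissible_iff_log`, `admissible_iff_lt_threshold` (for `Λ > 1`: `a^{1−p}Λ^p < 1 ⟺ p < σ⋆ := log(1∕a) ∕ log(Λ∕a)`, and `σ⋆ < 1`), `exists_crossover_admissible_exponent`
(`0 < a < 1`, `Λ ≥ 0` ⟹ some `p ∈ ]0,1]` is admissible); ★ `summable_crossover_of_forall_rpowSummable` (a modulus `p`-summable for EVERY `p > 0` — geometric,
stretched-geometric — transports for every `0 < a < 1`, `Λ ≥ 0`); ★ `summable_crossover_of_geometric_modulus` and `summable_sum_min_pow_of_lt_one` (the tree's
`T4Crossover.summable_sum_min_pow` RECOVERED as the geometric instance, WITHOUT its hypothesis `θ ≤ Λ` and allowing `θ = 0`).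
§2 ★★ THE LOCATED NEGATIVE `summableModulus_not_sufficient_for_crossover`: at `(a, Λ) = (1∕2, 2)` the modulus `r_j = 1∕(j+1)²` is SUMMABLE, yet
`K ↦ Σ_{j+n=K} min((1∕2)ⁿ, r_j·2ⁿ)` is NOT summable (kernel: at `n = Nat.log 2 (K+1)` the term is `≥ 1∕(2(K+1))`, `crossover_witness_term_ge`; harmonic series);
and `not_rpowSummable_witness_of_admissible`: at that witness NO admissible exponent (`p < 1∕2`) has `Σ_j r_j^p < ∞` — the threshold's hypothesis is exactly what
fails.  So «summable two-run modulus» — K2⁷ line 2's hedge of node N17 — is INSUFFICIENT for the N19′ crossover.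
§3 DICTIONARY to the edge of record: `injectedRate_zero_iff_geometric_modulus` (`InjectedRate C 0 θ inj ⟺ ∀ K, ∀ j ≤ K, 0 ≤ inj K j ≤ C·θ^j`);
★ `summable_crossover_of_injectedRate` (the N19′ edge's N17 liaison ⟹ the crossover with the ACTUAL injected discrepancies `inj K j` is summable over `K`, every
`0 < a < 1`, `Λ ≥ 0`, `0 ≤ θ < 1`); `summable_crossover_of_injectedModulus_rpowSummable` (the same for a K-uniform MODULUS bound `inj K j ≤ r_j` with an admissible
`p`-summable `r`).

WHAT IT SAYS FOR K3⁷ (LOCATED; no stub text changes).  An injected two-run modulus `r` survives the N19′ crossover iff-in-substance `Σ_j r_j^p < ∞` for SOME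
admissible `p` (all admissible `p < σ⋆(a,Λ) < 1` once `Λ > 1`) — STRICTLY STRONGER than summability; hence K2⁷ line 2's summable hedge of node N17 has NO K3⁷
twin through the edge of record: K3⁷ v3's N17 conjunct `N17At` (NE4's GEOMETRIC `ScaleShiftRate`) is load-bearing for `stub_expansion13H`'s `KeyedCoreEdgeHolderD4`
as typed, and the correlated-failure reading is: a failure of NE4's GEOMETRIC rate with a surviving summable modulus kills the N19′ edge of record (K3⁷) while
K2⁷ line 2 survives — the two cruxes read node N17 at DIFFERENT strengths.  NOT typed here (honest): the node-U2-side conversion «full-β shift MODULUS `a_k` ⟹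
injected MODULUS `r_j`» — the tree's `T4CouplingMatching.disc_le_of_fadingMemory` is geometric-keyed; the threshold above is on the INJECTED modulus.

HONEST SCOPE (A6, director-ym №189).  Elementary real analysis ([folklore]: two-point interpolation, Cauchy products of non-negative series, `Nat.log`, the
`p`-series) over the tree's crossover SHAPE; every antecedent of §1∕§3 is inhabited by §1's geometric instance and §2's witness (no vacuity); nothing of
Bałaban asserted or instantiated; NE4 ∕ NE7 NOT PRINTED ([Balaban1987RG1] p. 264 «We will investigate other properties in a separate paper»;
[Balaban1989LargeFieldII] p. 356) and NOT proved; no K2⁷∕K3⁷ stub proved; N17 ∕ N19 NOT discharged; K2⁷ ∕ K3⁷ OPEN; counts UNMOVED (typed 28∕28 ·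
discharged 5∕27 · A 5∕28).  One finite four-torus programme at fixed `ε = L^{−K}`, Bałaban AS PRINTED; the YM mass gap (Clay) is NOT proved by any of this —
R4 closes the conditional finite-𝕋⁴ rung `BalabanLadder.UV` only; nothing continuum ∕ ℝ⁴ ∕ OS.  No `instance`, no `notation`, no `axiom`.
References: [Balaban1987RG1] T. Bałaban, Commun. Math. Phys. **109** (1987) 249–301, (0.26) p. 257, p. 264; [Balaban1988Convergent] Commun. Math. Phys.
**119** (1988), Thm 2 (2.43) p. 263; [GawedzkiKupiainen1985] Commun. Math. Phys. **99** (1985), (142)–(143); [King1986] Thm 3.4 (3.9) p. 656 (template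
of the geometric shape, cited by `T4CauchySum.InjectedRate`).
-/

noncomputable section

namespace Summit.QuantumFields.YangMills.BalabanUVNodes.N17ShiftModulusCrossover

open Literature.MathematicalPhysics.QuantumFieldTheory.Balaban1983to89
open Literature.MathematicalPhysics.QuantumFieldTheory.Balaban1983to89.T4Crossover (min_le_rpow_mul_rpow)
open Literature.MathematicalPhysics.QuantumFieldTheory.Balaban1983to89.T4CauchySum (InjectedRate)
open Finset

/-! ## §1 The threshold: `p`-summable injected moduli with an admissible exponent survive the crossover -/

section Threshold

variable {a Λ p : ℝ} {r : ℕ → ℝ}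

/-- ONE TERM, two-point interpolation at `t = 1 − p`: for `a, Λ, r_j ≥ 0` and `0 ≤ p ≤ 1`,
`min(aⁿ, r_j·Λⁿ) ≤ r_j^p · (a^{1−p}·Λ^p)ⁿ` (`T4Crossover.min_le_rpow_mul_rpow`, `Real.rpow_pow_comm`). [folklore] -/
theorem min_le_rpow_modulus_mul_pow {ρ : ℝ} (ha : 0 ≤ a) (hΛ : 0 ≤ Λ) (hρ : 0 ≤ ρ) (hp0 : 0 ≤ p) (hp1 : p ≤ 1) (n : ℕ) :
    min (a ^ n) (ρ * Λ ^ n) ≤ ρ ^ p * (a ^ (1 - p) * Λ ^ p) ^ n := by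
  have h1 := min_le_rpow_mul_rpow (pow_nonneg ha n) (mul_nonneg hρ (pow_nonneg hΛ n)) (t := 1 - p) (by linarith) (by linarith)
  have hp : (1 : ℝ) - (1 - p) = p := by ring
  rw [hp] at h1
  have h2 : (a ^ n) ^ (1 - p) * (ρ * Λ ^ n) ^ p = ρ ^ p * (a ^ (1 - p) * Λ ^ p) ^ n := by
    rw [Real.mul_rpow hρ (pow_nonneg hΛ n), ← Real.rpow_pow_comm ha, ← Real.rpow_pow_comm hΛ, mul_pow]
    ring
  rw [h2] at h1
  exact h1

/-- THE `K`-TH ANTIDIAGONAL under a modulus `r ≥ 0`: `Σ_{j+n=K} min(aⁿ, r_j·Λⁿ) ≤ Σ_{j+n=K} r_j^p · (a^{1−p}·Λ^p)ⁿ` — a Cauchy-product term of the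
sequences `r^p` and the geometric `(a^{1−p}Λ^p)ⁿ`. [folklore] -/
theorem sum_min_modulus_le (ha : 0 ≤ a) (hΛ : 0 ≤ Λ) (hr : ∀ j, 0 ≤ r j) (hp0 : 0 ≤ p) (hp1 : p ≤ 1) (K : ℕ) :
    ∑ x ∈ antidiagonal K, min (a ^ x.2) (r x.1 * Λ ^ x.2) ≤ ∑ x ∈ antidiagonal K, r x.1 ^ p * (a ^ (1 - p) * Λ ^ p) ^ x.2 :=
  Finset.sum_le_sum fun x _ => min_le_rpow_modulus_mul_pow ha hΛ (hr x.1) hp0 hp1 x.2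

/-- the crossover terms are non-negative (for `Summable.of_nonneg_of_le`). [folklore] -/
theorem sum_min_modulus_nonneg (ha : 0 ≤ a) (hΛ : 0 ≤ Λ) (hr : ∀ j, 0 ≤ r j) (K : ℕ) :
    0 ≤ ∑ x ∈ antidiagonal K, min (a ^ x.2) (r x.1 * Λ ^ x.2) :=
  Finset.sum_nonneg fun x _ => le_min (pow_nonneg ha x.2) (mul_nonneg (hr x.1) (pow_nonneg hΛ x.2))

/-- ★ **THE TRANSPORT THRESHOLD (sufficiency).**  For `a, Λ ≥ 0`, a modulus `r ≥ 0` and an exponent `0 ≤ p ≤ 1` which is ADMISSIBLE, `a^{1−p}·Λ^p < 1`, and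
for which `Σ_j r_j^p < ∞`: the crossover sums `K ↦ Σ_{j+n=K} min(aⁿ, r_j·Λⁿ)` are summable over the number of steps `K` (termwise interpolation, then the
Cauchy product of the non-negative summable sequences `r^p` and `(a^{1−p}Λ^p)ⁿ`, `summable_sum_mul_antidiagonal_of_summable_mul`).  The GEOMETRIC modulus of the
tree's `T4Crossover.summable_sum_min_pow` is the instance `r_j = θ^j` (every `p > 0` works, §1 below); a merely SUMMABLE modulus is NOT enough (§2). [folklore] -/
theorem summable_crossover_of_rpowSummable (ha : 0 ≤ a) (hΛ : 0 ≤ Λ) (hr : ∀ j, 0 ≤ r j) (hp0 : 0 ≤ p) (hp1 : p ≤ 1)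
    (hq : a ^ (1 - p) * Λ ^ p < 1) (hs : Summable fun j => r j ^ p) :
    Summable fun K => ∑ x ∈ antidiagonal K, min (a ^ x.2) (r x.1 * Λ ^ x.2) := by
  set c : ℝ := a ^ (1 - p) * Λ ^ p with hc
  have hq0 : 0 ≤ c := mul_nonneg (Real.rpow_nonneg ha _) (Real.rpow_nonneg hΛ _)
  have hg : Summable fun n : ℕ => c ^ n := summable_geometric_of_lt_one hq0 hq
  have hf' : ∀ j : ℕ, 0 ≤ r j ^ p := fun j => Real.rpow_nonneg (hr j) p
  have hg' : ∀ n : ℕ, 0 ≤ c ^ n := fun n => pow_nonneg hq0 n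
  have hprod : Summable fun x : ℕ × ℕ => r x.1 ^ p * c ^ x.2 :=
    Summable.mul_of_nonneg (f := fun j : ℕ => r j ^ p) (g := fun n : ℕ => c ^ n) hs hg (fun j => hf' j) (fun n => hg' n)
  have hC : Summable fun K : ℕ => ∑ x ∈ antidiagonal K, r x.1 ^ p * c ^ x.2 :=
    summable_sum_mul_antidiagonal_of_summable_mul (f := fun j : ℕ => r j ^ p) (g := fun n : ℕ => c ^ n) hprod
  refine Summable.of_nonneg_of_le (f := fun K : ℕ => ∑ x ∈ antidiagonal K, r x.1 ^ p * c ^ x.2)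
    (fun K => sum_min_modulus_nonneg ha hΛ hr K) (fun K => ?_) hC
  exact sum_min_modulus_le ha hΛ hr hp0 hp1 K

/-- ADMISSIBILITY IN LOGARITHMS: for `a, Λ > 0`, `a^{1−p}·Λ^p < 1 ⟺ (1−p)·log a + p·log Λ < 0`. [folklore] -/
theorem admissible_iff_log (ha : 0 < a) (hΛ : 0 < Λ) :
    a ^ (1 - p) * Λ ^ p < 1 ↔ (1 - p) * Real.log a + p * Real.log Λ < 0 := by
  have h1 : 0 < a ^ (1 - p) := Real.rpow_pos_of_pos ha _
  have h2 : 0 < Λ ^ p := Real.rpow_pos_of_pos hΛ _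
  rw [← Real.log_neg_iff (mul_pos h1 h2), Real.log_mul h1.ne' h2.ne', Real.log_rpow ha, Real.log_rpow hΛ]

/-- THE THRESHOLD EXPONENT: for `0 < a < 1 < Λ` the admissible exponents are exactly `p < σ⋆ := log(1∕a) ∕ log(Λ∕a)` (both logarithms positive). [folklore] -/
theorem admissible_iff_lt_threshold (ha0 : 0 < a) (ha1 : a < 1) (hΛ : 1 < Λ) :
    a ^ (1 - p) * Λ ^ p < 1 ↔ p < Real.log (1 / a) / Real.log (Λ / a) := by
  have hΛ0 : 0 < Λ := one_pos.trans hΛ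
  have hA : Real.log a < 0 := Real.log_neg ha0 ha1
  have hL : 0 < Real.log Λ := Real.log_pos hΛ
  have h1 : Real.log (1 / a) = -Real.log a := by rw [one_div, Real.log_inv]
  have h2 : Real.log (Λ / a) = Real.log Λ - Real.log a := Real.log_div hΛ0.ne' ha0.ne'
  rw [admissible_iff_log ha0 hΛ0, h1, h2, lt_div_iff₀ (by linarith)]
  constructor <;> intro h <;> nlinarith

/-- … and that threshold is STRICTLY BELOW ONE when `Λ > 1`: `σ⋆ = log(1∕a) ∕ log(Λ∕a) < 1` — so `p = 1` (plain summability of `r`) is NEVER admissible against a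
multiplicity base above one. [folklore] -/
theorem threshold_lt_one (ha0 : 0 < a) (ha1 : a < 1) (hΛ : 1 < Λ) :
    Real.log (1 / a) / Real.log (Λ / a) < 1 := by
  have hΛ0 : 0 < Λ := one_pos.trans hΛ
  have hA : Real.log a < 0 := Real.log_neg ha0 ha1
  have hL : 0 < Real.log Λ := Real.log_pos hΛ
  have h1 : Real.log (1 / a) = -Real.log a := by rw [one_div, Real.log_inv]
  have h2 : Real.log (Λ / a) = Real.log Λ - Real.log a := Real.log_div hΛ0.ne' ha0.ne'
  rw [h1, h2, div_lt_one (by linarith)]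
  linarith

/-- the threshold is POSITIVE for `0 < a < 1 ≤ Λ`. [folklore] -/
theorem threshold_pos (ha0 : 0 < a) (ha1 : a < 1) (hΛ : 1 ≤ Λ) :
    0 < Real.log (1 / a) / Real.log (Λ / a) := by
  have hA : 0 < Real.log (1 / a) := Real.log_pos (one_lt_one_div ha0 ha1)
  have hB : 0 < Real.log (Λ / a) := Real.log_pos (by rw [lt_div_iff₀ ha0, one_mul]; linarith)
  exact div_pos hA hB

/-- ADMISSIBLE EXPONENTS EXIST: for `0 < a < 1` and `Λ ≥ 0` some `p ∈ ]0, 1]` has `a^{1−p}·Λ^p < 1` (`p = 1∕2` if `Λ ≤ 1`; `p = σ⋆∕2` if `Λ > 1`). [folklore] -/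
theorem exists_crossover_admissible_exponent (ha0 : 0 < a) (ha1 : a < 1) (hΛ : 0 ≤ Λ) :
    ∃ p : ℝ, 0 < p ∧ p ≤ 1 ∧ a ^ (1 - p) * Λ ^ p < 1 := by
  rcases le_or_gt Λ 1 with hΛ1 | hΛ1
  · refine ⟨1 / 2, by norm_num, by norm_num, ?_⟩
    have h1 : a ^ (1 - 1 / 2 : ℝ) < 1 := Real.rpow_lt_one ha0.le ha1 (by norm_num)
    have h2 : Λ ^ (1 / 2 : ℝ) ≤ 1 := Real.rpow_le_one hΛ hΛ1 (by norm_num)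
    have h3 : 0 ≤ Λ ^ (1 / 2 : ℝ) := Real.rpow_nonneg hΛ _
    have h4 : 0 < a ^ (1 - 1 / 2 : ℝ) := Real.rpow_pos_of_pos ha0 _
    nlinarith
  · set σ : ℝ := Real.log (1 / a) / Real.log (Λ / a) with hσ
    have hσ0 : 0 < σ := threshold_pos ha0 ha1 hΛ1.le
    have hσ1 : σ < 1 := threshold_lt_one ha0 ha1 hΛ1
    refine ⟨σ / 2, by linarith, by linarith, ?_⟩
    rw [admissible_iff_lt_threshold ha0 ha1 hΛ1, ← hσ]
    linarith

/-- ★ **MODULI `p`-SUMMABLE FOR EVERY `p > 0` TRANSPORT FOR EVERY `(a, Λ)`**: if `Σ_j r_j^p < ∞` for all `0 < p ≤ 1` (every geometric or stretched-geometric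
modulus), then the crossover sums are summable for every `0 < a < 1`, `Λ ≥ 0` — whatever the multiplicity base. [folklore] -/
theorem summable_crossover_of_forall_rpowSummable (ha0 : 0 < a) (ha1 : a < 1) (hΛ : 0 ≤ Λ) (hr : ∀ j, 0 ≤ r j)
    (hs : ∀ p : ℝ, 0 < p → p ≤ 1 → Summable fun j => r j ^ p) :
    Summable fun K => ∑ x ∈ antidiagonal K, min (a ^ x.2) (r x.1 * Λ ^ x.2) := by
  obtain ⟨p, hp0, hp1, hq⟩ := exists_crossover_admissible_exponent ha0 ha1 hΛ
  exact summable_crossover_of_rpowSummable ha0.le hΛ hr hp0.le hp1 hq (hs p hp0 hp1)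

/-- a GEOMETRIC modulus is `p`-summable for every `p > 0`: `r_j ≤ C·θ^j`, `0 ≤ θ < 1` ⟹ `Σ_j r_j^p < ∞` (comparison with `C^p·(θ^p)^j`, `θ^p < 1`). [folklore] -/
theorem rpowSummable_of_geometric_modulus {C θ : ℝ} (hθ0 : 0 ≤ θ) (hθ1 : θ < 1) (hr0 : ∀ j, 0 ≤ r j) (hr : ∀ j, r j ≤ C * θ ^ j)
    (hp0 : 0 < p) : Summable fun j => r j ^ p := by
  have hC : 0 ≤ C := by simpa using (hr0 0).trans (hr 0)
  have hθp0 : 0 ≤ θ ^ p := Real.rpow_nonneg hθ0 _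
  have hθp1 : θ ^ p < 1 := Real.rpow_lt_one hθ0 hθ1 hp0
  have hg : Summable fun j : ℕ => C ^ p * (θ ^ p) ^ j := (summable_geometric_of_lt_one hθp0 hθp1).mul_left _
  refine Summable.of_nonneg_of_le (fun j => Real.rpow_nonneg (hr0 j) _) (fun j => ?_) hg
  calc r j ^ p ≤ (C * θ ^ j) ^ p := Real.rpow_le_rpow (hr0 j) (hr j) hp0.le
    _ = C ^ p * (θ ^ p) ^ j := by rw [Real.mul_rpow hC (pow_nonneg hθ0 j), Real.rpow_pow_comm hθ0]

/-- ★ **THE GEOMETRIC INSTANCE**: a modulus dominated by a geometric rate, `0 ≤ r_j ≤ C·θ^j` with `0 ≤ θ < 1`, survives the crossover for every `0 < a < 1` and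
every multiplicity base `Λ ≥ 0` — the content of `T4Crossover.summable_sum_min_pow`, reached through the threshold. [folklore] -/
theorem summable_crossover_of_geometric_modulus {C θ : ℝ} (ha0 : 0 < a) (ha1 : a < 1) (hΛ : 0 ≤ Λ) (hθ0 : 0 ≤ θ) (hθ1 : θ < 1)
    (hr0 : ∀ j, 0 ≤ r j) (hr : ∀ j, r j ≤ C * θ ^ j) :
    Summable fun K => ∑ x ∈ antidiagonal K, min (a ^ x.2) (r x.1 * Λ ^ x.2) :=
  summable_crossover_of_forall_rpowSummable ha0 ha1 hΛ hr0 fun _ hp0 _ => rpowSummable_of_geometric_modulus hθ0 hθ1 hr0 hr hp0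

/-- THE TREE'S CROSSOVER LEMMA RECOVERED (and slightly widened): `T4Crossover.summable_sum_min_pow`'s conclusion for `0 < a < 1`, `0 ≤ θ < 1`, `Λ ≥ 0` —
WITHOUT its hypothesis `θ ≤ Λ` and allowing `θ = 0`. [folklore] -/
theorem summable_sum_min_pow_of_lt_one {θ : ℝ} (ha0 : 0 < a) (ha1 : a < 1) (hθ0 : 0 ≤ θ) (hθ1 : θ < 1) (hΛ : 0 ≤ Λ) :
    Summable fun K : ℕ => ∑ x ∈ antidiagonal K, min (a ^ x.2) (θ ^ x.1 * Λ ^ x.2) :=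
  summable_crossover_of_geometric_modulus (r := fun j => θ ^ j) (C := 1) ha0 ha1 hΛ hθ0 hθ1 (fun j => pow_nonneg hθ0 j)
    fun j => by rw [one_mul]

end Threshold

/-! ## §2 The located negative: a SUMMABLE injected modulus does NOT survive the crossover -/

section Negative

/-- THE KERNEL OF THE WITNESS: at `(a, Λ) = (1∕2, 2)` and `r_j = 1∕(j+1)²`, the `K`-th crossover sum is `≥ 1∕(2(K+1))` — read the single term at
`n = Nat.log 2 (K+1)` remaining scales (`2ⁿ ≤ K+1 < 2ⁿ⁺¹`): there `(1∕2)ⁿ ≥ 1∕(K+1)` and `r_{K−n}·2ⁿ ≥ (K+1)∕(2(K+1)²)`. [folklore] -/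
theorem crossover_witness_term_ge (K : ℕ) :
    1 / (2 * ((K : ℝ) + 1)) ≤ ∑ x ∈ antidiagonal K, min ((1 / 2 : ℝ) ^ x.2) (1 / ((x.1 : ℝ) + 1) ^ 2 * 2 ^ x.2) := by
  set n : ℕ := Nat.log 2 (K + 1) with hn
  have hK1 : K + 1 ≠ 0 := Nat.succ_ne_zero K
  have hnK : n ≤ K := Nat.lt_succ_iff.mp (Nat.log_lt_self 2 hK1)
  have hpow_le : 2 ^ n ≤ K + 1 := Nat.pow_log_le_self 2 hK1
  have hlt_pow : K + 1 < 2 ^ (n + 1) := Nat.lt_pow_succ_log_self one_lt_two (K + 1)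
  -- real casts of the two `Nat.log` facts
  have hpow_le' : (2 : ℝ) ^ n ≤ (K : ℝ) + 1 := by exact_mod_cast hpow_le
  have hlt_pow' : (K : ℝ) + 1 < 2 ^ n * 2 := by
    have h : ((K + 1 : ℕ) : ℝ) < ((2 ^ (n + 1) : ℕ) : ℝ) := by exact_mod_cast hlt_pow
    push_cast at h
    rw [pow_succ] at h
    exact h
  have hKpos : (0 : ℝ) < (K : ℝ) + 1 := by positivity
  have h2n : (0 : ℝ) < 2 ^ n := by positivity
  -- the selected pair lies on the antidiagonal
  have hmem : (K - n, n) ∈ antidiagonal K := mem_antidiagonal.mpr (Nat.sub_add_cancel hnK)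
  have hnonneg : ∀ x ∈ antidiagonal K, 0 ≤ min ((1 / 2 : ℝ) ^ x.2) (1 / ((x.1 : ℝ) + 1) ^ 2 * 2 ^ x.2) := fun x _ =>
    le_min (pow_nonneg (by norm_num) _) (mul_nonneg (by positivity) (pow_nonneg (by norm_num) _))
  refine le_trans ?_ (Finset.single_le_sum hnonneg hmem)
  -- the term at `(K − n, n)`
  have hj : (((K - n : ℕ) : ℝ) + 1) ≤ (K : ℝ) + 1 := by
    have : ((K - n : ℕ) : ℝ) ≤ (K : ℝ) := by exact_mod_cast Nat.sub_le K n
    linarith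
  have hjpos : (0 : ℝ) < ((K - n : ℕ) : ℝ) + 1 := by positivity
  refine le_min ?_ ?_
  · -- `(1∕2)ⁿ = 1∕2ⁿ ≥ 1∕(K+1) ≥ 1∕(2(K+1))`
    rw [one_div_pow]
    exact one_div_le_one_div_of_le h2n (by linarith)
  · -- `r_{K−n}·2ⁿ ≥ (1∕(K+1)²)·((K+1)∕2) = 1∕(2(K+1))`
    have h1 : 1 / ((K : ℝ) + 1) ^ 2 ≤ 1 / (((K - n : ℕ) : ℝ) + 1) ^ 2 :=
      one_div_le_one_div_of_le (pow_pos hjpos 2) (pow_le_pow_left₀ hjpos.le hj 2)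
    have h2 : ((K : ℝ) + 1) / 2 ≤ 2 ^ n := by linarith
    calc 1 / (2 * ((K : ℝ) + 1)) = 1 / ((K : ℝ) + 1) ^ 2 * (((K : ℝ) + 1) / 2) := by
          field_simp
      _ ≤ 1 / (((K - n : ℕ) : ℝ) + 1) ^ 2 * 2 ^ n :=
          mul_le_mul h1 h2 (by positivity) (by positivity)

/-- ★★ **THE LOCATED NEGATIVE — A SUMMABLE TWO-RUN MODULUS DOES NOT SURVIVE THE N19′ CROSSOVER.**  At the contraction `a = 1∕2` and the multiplicity base
`Λ = 2` (any `Λ > 1` behaves alike), the injected modulus `r_j = 1∕(j+1)²` is SUMMABLE, yet the crossover sums `K ↦ Σ_{j+n=K} min((1∕2)ⁿ, r_j·2ⁿ)` are NOT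
summable over the number of steps (each is `≥ 1∕(2(K+1))`: harmonic).  Consequence for K3⁷ (module docstring): K2⁷ line 2's SUMMABLE hedge of node N17
(`…N17ShiftModulusAnchorRecord13.everySlope13_of_summableShift_anchor`) has no twin through the N19′ edge of record, whose `Summable δ` is this crossover with the
GEOMETRIC injected rate of `YMDAG.UVSplit.N17At`. [folklore] -/
theorem summableModulus_not_sufficient_for_crossover :
    Summable (fun j : ℕ => 1 / ((j : ℝ) + 1) ^ 2) ∧
      ¬ Summable (fun K : ℕ => ∑ x ∈ antidiagonal K, min ((1 / 2 : ℝ) ^ x.2) (1 / ((x.1 : ℝ) + 1) ^ 2 * 2 ^ x.2)) := by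
  -- the witness modulus is summable (shifted `p`-series, `p = 2`; the tree's `Literature.NumberTheory.Transcendental.GenusZeroPeriodsMZV.
  -- summable_one_div_nat_add_one_sq` states the same — re-derived in two lines rather than importing that module into a YM file)
  have hr : Summable (fun j : ℕ => 1 / ((j : ℝ) + 1) ^ 2) := by
    have h := (summable_nat_add_iff 1).mpr (Real.summable_one_div_nat_pow.mpr one_lt_two)
    simp only [Nat.cast_add, Nat.cast_one] at h
    exact h
  refine ⟨hr, fun h => ?_⟩
  have h1 : Summable fun K : ℕ => 1 / (2 * ((K : ℝ) + 1)) :=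
    Summable.of_nonneg_of_le (fun K => by positivity) crossover_witness_term_ge h
  have h2 : Summable fun K : ℕ => (fun m : ℕ => 1 / (m : ℝ)) (K + 1) := by
    refine (h1.mul_left 2).congr fun K => ?_
    push_cast
    field_simp
  exact Real.not_summable_one_div_natCast ((summable_nat_add_iff 1).mp h2)

/-- SHARPNESS AT THE WITNESS: at `(a, Λ) = (1∕2, 2)` the threshold exponent is `σ⋆ = log 2 ∕ log 4 = 1∕2`, and for every ADMISSIBLE `p`
(`(1∕2)^{1−p}·2^p < 1`, i.e. `p < 1∕2`; the sign of `p` is immaterial) the witness modulus is NOT `p`-summable: `Σ_j (1∕(j+1)²)^p = Σ_j (j+1)^{−2p} = ∞` (`2p < 1`) — the hypothesis of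
`summable_crossover_of_rpowSummable` is EXACTLY what fails. [folklore] -/
theorem not_rpowSummable_witness_of_admissible {p : ℝ} (hadm : (1 / 2 : ℝ) ^ (1 - p) * (2 : ℝ) ^ p < 1) :
    ¬ Summable (fun j : ℕ => (1 / ((j : ℝ) + 1) ^ 2) ^ p) := by
  -- admissibility at the witness reads `p < log 2 ∕ log 4 = 1∕2`
  have hth := (admissible_iff_lt_threshold (a := 1 / 2) (Λ := 2) (p := p) (by norm_num) (by norm_num) (by norm_num)).mp hadm
  have hlog : Real.log (1 / (1 / 2 : ℝ)) / Real.log (2 / (1 / 2 : ℝ)) = 1 / 2 := by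
    have h4 : (2 / (1 / 2 : ℝ)) = 2 ^ 2 := by norm_num
    rw [one_div_one_div, h4, Real.log_pow]
    have h2 : 0 < Real.log 2 := Real.log_pos one_lt_two
    field_simp
    ring
  rw [hlog] at hth
  -- the summand is the shifted `p`-series term `((j+1)^{2p})⁻¹`
  intro hs
  have hs' : Summable fun j : ℕ => (fun m : ℕ => ((m : ℝ) ^ (2 * p))⁻¹) (j + 1) := by
    refine hs.congr fun j => ?_
    have hj : (0 : ℝ) ≤ (j : ℝ) + 1 := by positivity
    push_cast
    rw [one_div, Real.inv_rpow (pow_nonneg hj 2), ← Real.rpow_natCast_mul hj]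
    norm_num
  have := (Real.summable_nat_rpow_inv.mp ((summable_nat_add_iff 1).mp hs'))
  linarith

end Negative

/-! ## §3 Dictionary to the N19′ edge of record: its N17 liaison `InjectedRate C 0 θ` IS the geometric-modulus instance -/

section Dictionary

variable {a Λ : ℝ}

/-- `T4CauchySum.InjectedRate C 0 θ inj` — the N19′ edge's liaison reading of node N17 (`N19RateEdge.rateEdge_of_linkReading`'s `hinj17`, produced by
`T4CouplingMatching.injectedRate_of_runs_eventual` from `ScaleShiftRate`) — says exactly: every cutoff slice `j ↦ inj K j` (`j ≤ K`) is NON-NEGATIVE and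
dominated by the GEOMETRIC modulus `C·θ^j`, UNIFORMLY in `K` (the polynomial factor `(K+1)^0 = 1`). [folklore] -/
theorem injectedRate_zero_iff_geometric_modulus {C θ : ℝ} {inj : ℕ → ℕ → ℝ} :
    InjectedRate C 0 θ inj ↔ ∀ K j : ℕ, j ≤ K → 0 ≤ inj K j ∧ inj K j ≤ C * θ ^ j := by
  simp only [InjectedRate, pow_zero, mul_one]

/-- ★ **THE EDGE'S HYPOTHESIS SHAPE TRANSPORTS**: under `InjectedRate C 0 θ inj` with `0 ≤ θ < 1`, the crossover sums with the ACTUAL injected discrepancies,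
`K ↦ Σ_{j+n=K} min(aⁿ, inj K j·Λⁿ)`, are summable over `K` for every `0 < a < 1` and every multiplicity base `Λ ≥ 0` (termwise domination by the geometric
modulus `C·θ^j` on the antidiagonal, where `j ≤ K`, then §1). [folklore] -/
theorem summable_crossover_of_injectedRate {C θ : ℝ} {inj : ℕ → ℕ → ℝ} (h : InjectedRate C 0 θ inj) (hθ0 : 0 ≤ θ) (hθ1 : θ < 1)
    (ha0 : 0 < a) (ha1 : a < 1) (hΛ : 0 ≤ Λ) :
    Summable fun K => ∑ x ∈ antidiagonal K, min (a ^ x.2) (inj K x.1 * Λ ^ x.2) := by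
  rw [injectedRate_zero_iff_geometric_modulus] at h
  have hC : 0 ≤ C := by simpa using (h 0 0 le_rfl).1.trans (h 0 0 le_rfl).2
  have hdom := summable_crossover_of_geometric_modulus (r := fun j => C * θ ^ j) (C := C) ha0 ha1 hΛ hθ0 hθ1
    (fun j => mul_nonneg hC (pow_nonneg hθ0 j)) (fun j => le_rfl)
  refine Summable.of_nonneg_of_le (fun K => Finset.sum_nonneg fun x hx => ?_) (fun K => Finset.sum_le_sum fun x hx => ?_) hdom
  · have hjK : x.1 ≤ K := by have := mem_antidiagonal.mp hx; omega
    exact le_min (pow_nonneg ha0.le _) (mul_nonneg (h K x.1 hjK).1 (pow_nonneg hΛ _))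
  · have hjK : x.1 ≤ K := by have := mem_antidiagonal.mp hx; omega
    exact min_le_min le_rfl (mul_le_mul_of_nonneg_right (h K x.1 hjK).2 (pow_nonneg hΛ _))

/-- THE SAME FOR A K-UNIFORM MODULUS BOUND: if every cutoff slice of the injected discrepancies is dominated by ONE modulus, `0 ≤ inj K j ≤ r_j` (`j ≤ K`), and
`r` is `p`-summable at an admissible exponent (`0 ≤ p ≤ 1`, `a^{1−p}·Λ^p < 1`), the crossover sums with the actual discrepancies are summable over `K` — the
exact weakening of the edge's N17 liaison that the N19′ crossover tolerates (§2: NOT down to plain summability). [folklore] -/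
theorem summable_crossover_of_injectedModulus_rpowSummable {p : ℝ} {r : ℕ → ℝ} {inj : ℕ → ℕ → ℝ}
    (h : ∀ K j : ℕ, j ≤ K → 0 ≤ inj K j ∧ inj K j ≤ r j) (ha : 0 ≤ a) (hΛ : 0 ≤ Λ) (hp0 : 0 ≤ p) (hp1 : p ≤ 1)
    (hq : a ^ (1 - p) * Λ ^ p < 1) (hs : Summable fun j => r j ^ p) :
    Summable fun K => ∑ x ∈ antidiagonal K, min (a ^ x.2) (inj K x.1 * Λ ^ x.2) := by
  have hr : ∀ j, 0 ≤ r j := fun j => (h j j le_rfl).1.trans (h j j le_rfl).2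
  have hdom := summable_crossover_of_rpowSummable ha hΛ hr hp0 hp1 hq hs
  refine Summable.of_nonneg_of_le (fun K => Finset.sum_nonneg fun x hx => ?_) (fun K => Finset.sum_le_sum fun x hx => ?_) hdom
  · have hjK : x.1 ≤ K := by have := mem_antidiagonal.mp hx; omega
    exact le_min (pow_nonneg ha _) (mul_nonneg (h K x.1 hjK).1 (pow_nonneg hΛ _))
  · have hjK : x.1 ≤ K := by have := mem_antidiagonal.mp hx; omega
    exact min_le_min le_rfl (mul_le_mul_of_nonneg_right (h K x.1 hjK).2 (pow_nonneg hΛ _))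

end Dictionary

end Summit.QuantumFields.YangMills.BalabanUVNodes.N17ShiftModulusCrossover

end
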